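import Literature.AnabelianGeometry.EtaleTheta.ThetaCoversTemperedModelDefs
import Literature.AnabelianGeometry.EtaleTheta.Discharge.Sec3TemperedFilterWitness
import HarnessLib

/-!
# [EtTh] Def. 3.3 (i) AT the Def. 2.5 model: the model's tempered group `Π^tp_C = A × ℤ` carries a tempered filter
# (proof-only cross-link of the NV-L2 witnesses `TemperedFilter` and `TemperedCoverData`)

S. Mochizuki, *The étale theta function …*, Publ. RIMS **45** (2009) [MochizukiEtTh2009], Def. 3.3 (i) p.298 (PDF p.72)
("a tempered filter on `Δ`", for the tempered group of the curve) and Def. 2.5 p.265 (PDF p.39) (`Π^tp_C`).  abc-iut cell,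
layer L2, NV programme (seat abc-iut-w5-d118; companion of `Discharge/Sec3TemperedFilterWitness.lean` p424847/p425653 and of
the `TemperedCoverData` model `ThetaCoversTemperedModelDefs.lean` p430754 / `Discharge/Sec2TemperedCoverDataModel.lean` p431045).
PROOF-ONLY: the tempered group `Π^tp_C = (heisPiC l × ℤ/2) × ℤ` of the model is VIRTUALLY FREE (the infinite cyclic factor
`1 × ℤ` has finite index), finitely generated and discrete, so `TemperedFilter.nonempty_of_virtuallyFree` applies: it carries a
tempered filter with `Δ^{fil,∞}_i = {1}` — the two NV witnesses are compatible (Def. 3.3 (i) is inhabited AT the tempered group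
of the Def. 2.5 model, not merely at some unrelated group).  CONSISTENCY/TOY; no side taken on [IUTchIII] Cor. 3.12; typed ≠ proved.
-/

noncomputable section

namespace Literature.AnabelianGeometry.EtaleTheta

namespace ThetaCovers

namespace TemperedModel

variable (l : ℕ) [NeZero l]

omit [NeZero l] in
/-- The infinite cyclic factor `1 × ℤ ⊆ Π^tp_C = A × ℤ` is a free group. (toy bookkeeping) [cite: MochizukiEtTh2009, Def 2.5 p.39] -/
theorem isFreeGroup_botProdTop :
    IsFreeGroup ((⊥ : Subgroup (TA l)).prod (⊤ : Subgroup (Multiplicative ℤ))) := by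
  haveI : IsFreeGroup (Multiplicative ℤ) := IsFreeGroup.ofMulEquiv (FreeGroup.mulEquivIntOfUnique (α := Unit))
  let f : Multiplicative ℤ →* GtpM l := MonoidHom.inr (TA l) (Multiplicative ℤ)
  have hf : Function.Injective f := fun a b h => by simpa [f] using congrArg Prod.snd h
  have hrange : f.range = (⊥ : Subgroup (TA l)).prod ⊤ := by
    ext ⟨a, n⟩
    simp only [MonoidHom.mem_range, Subgroup.mem_prod, Subgroup.mem_bot, Subgroup.mem_top, and_true, f,
      MonoidHom.inr_apply, Prod.mk.injEq]
    exact ⟨fun ⟨m, hm⟩ => hm.1.symm, fun h => ⟨n, h.symm, rfl⟩⟩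
  exact IsFreeGroup.ofMulEquiv ((MonoidHom.ofInjective hf).trans (MulEquiv.subgroupCongr hrange))

/-- `1 × ℤ` has finite index `#A` in `Π^tp_C = A × ℤ`. (toy bookkeeping) [cite: MochizukiEtTh2009, Def 2.5 p.39] -/
theorem finiteIndex_botProdTop : ((⊥ : Subgroup (TA l)).prod (⊤ : Subgroup (Multiplicative ℤ))).FiniteIndex := by
  refine ⟨?_⟩
  rw [Subgroup.index_prod, Subgroup.index_top, mul_one, Subgroup.index_bot]
  exact Nat.card_pos.ne'

/-- **Def. 3.3 (i) at the Def. 2.5 model**: the model's tempered group `Π^tp_C = A × ℤ` (discrete, finitely generated,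
virtually free) carries a tempered filter (`TemperedFilter.nonempty_of_virtuallyFree`).
[cite: MochizukiEtTh2009, Def 3.3 (i) p.72] -/
theorem nonempty_temperedFilter_GtpM : Nonempty (TemperedFilter (GtpM l)) := by
  haveI := isFreeGroup_botProdTop l
  haveI := finiteIndex_botProdTop l
  haveI : Group.FG (TA l) := Group.fg_of_finite
  haveI : Group.FG (Multiplicative ℤ) := by
    haveI : IsFreeGroup (Multiplicative ℤ) := IsFreeGroup.ofMulEquiv (FreeGroup.mulEquivIntOfUnique (α := Unit))
    infer_instance
  haveI : Group.FG (GtpM l) := inferInstanceAs (Group.FG (TA l × Multiplicative ℤ))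
  exact TemperedFilter.nonempty_of_virtuallyFree (GtpM l) ((⊥ : Subgroup (TA l)).prod ⊤)

end TemperedModel

end ThetaCovers

end Literature.AnabelianGeometry.EtaleTheta
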